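import Summits.AnomalousDissipation.AnomalousDissipation.Theorems.SolenoidalFractalHomogenisationLagrangianStepOddNonExpansion
import Summits.AnomalousDissipation.AnomalousDissipation.Theorems.IsotropicCubatureWord
import Mathlib.Algebra.QuadraticDiscriminant
import HarnessLib

/-!
# The STRICT reversed-Minkowski inequality for transverse line forms, in Gram form (p5's (L4) odd-gain certificate, ELEMENTARY) (K1L_D helper)

Helper file of route `SolenoidalFractalHomogenisation`, crux K1L_D `LagrangianRenormalisationStepDesign` (stmt-AnomalousDissipation-27980),
registered stub `stub_cellLawV0_IS` (W5 sectorial window, ODD half `SectorialOddChannelBoundOn … κ ε τ₀`, `κ < 1`).  Planner ad-ideate-p5's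
certificate chain (`Cruxes/LagrangianRenormalisationStep/OddGainCertificateSketch.lean`, (L0)–(L5)) reduces the contraction factor `κ = γ` of the
Kato sector under the quasi-static excess map to ONE finite-dimensional inequality, (L4) `MinkowskiDefectCert c γ`: a reversed Minkowski
inequality `Σ_i w_i √det A_i ≤ γ·√det(Σ_i w_i A_i)` with `γ < 1` for the compressions `A_i` to the output plane `κ⊥` of positive line forms whose
transverse spectra lie in a common box `[y, c·y]`.  Gen 7 certified it NUMERICALLY (interval branch-and-bound, kit j309739: `(c, γ) = (1.5, .795),
(2, .86), (2.6, .91), (3, .935), (4, .975)`); the cell's route of record for the Lean text was "equality case + compactness".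

THIS FILE replaces both by an ELEMENTARY KERNEL THEOREM with an explicit constant, in the GRAM FORM that composes directly with the landed
non-expansion argument (`…LagrangianStepOddNonExpansion`, p644915: `intro κ p q`, `bsymb_excQS`, per-slot sector data on the pair `(p, q)`):

* `gram2 M p q = (pᵀMp)(qᵀMq) − ((pᵀMq + qᵀMp)/2)²` — the Gram determinant of the symmetrised form of `M` on the pair `(p, q)`;
* `det_mono_two` — `2×2` determinant monotonicity `0 ≤ A ≤ A + D ⇒ det A ≤ det (A + D)` on Gram data;
* `gram2_perpMat_eq` — for a unit normal `n`, a unit output direction `κ` and `p, q ⊥ κ`: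
  `gram2 (1 − n nᵀ) p q = (n·κ)² · ((p·p)(q·q) − (p·q)²)` (the squared cosine between the planes `n⊥` and `κ⊥`; vector algebra only);
* **`strictMinkowski_gram`** — for weights `w_i ≥ 0`, unit normals `n_i`, response matrices `M_i` with `y·|P_{n_i}x|² ≤ xᵀM_ix ≤ c·y·|P_{n_i}x|²`,
  a lower frame constant `a` (`Σ_i w_i |P_{n_i} v|² ≥ a|v|²` on `κ⊥`) and `B ≥ Σ_i w_i |n_i·κ|`:
  `∀ p q ⊥ κ,  Σ_i w_i √(gram2 M_i p q) ≤ (c·B/a) · √(gram2 (Σ_i w_i • M_i) p q)`.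

§2 instantiates it for the 13-line / 26-slot cubature system `cubatureWord` (weights `slotW κ s = c_s(e_s·κ)²` and normals `slotN s = m̂_s`
of `bsymb_excQS`): `a = c₀` (`slotW_perpSq_sum`, an EQUALITY — isotropy in transverse-projector form, design identity `slotTermP_sum`) and
`B ≤ c₀·√5/3` (`slotW_abs_sum_le`: AM–GM `2√5|μ| ≤ 5μ² + 1` slot by slot + design identity `slotTermB_sum`, i.e. the moments
`Σ w = 280f`, `Σ wμ² = 56f`, `c₀ = 168f`, `f = 1/(119040π⁴)`), whence **`strictMinkowski_cubatureWord`** with the explicit factor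
`γ(c) = c·√5/3`, `< 1` for every box ratio `c < 3/√5 ≈ 1.3416` (`gamma_lt_one`) — no numerics, no compactness.  (The sharp constant is
`γ₀ = max_κ Σ_s w_s|m̂_s·κ|/c₀ = 0.65497`, i.e. `c < 1.527`; `√5/3 = 0.745` is the Cauchy–Schwarz relaxation.)  DESIGN READ-OFF for the
tenure / `stub_cellLawV0_IS`: `∃ ΛV > 1` is existential — take `ΛV ≤ 1.15`, so that the box ratio `c = (hi/lo)` of the per-slot transverse
response over the window stays `< 3/√5`.
§3 turns it into the STRICT TWIN of `oddSectorial_excQS_of_slot` (p644915): `sector_gram` (product-form Kato sector for all `x, z` ⇒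
Gram-form sector on every pair), `sector_sum_strict`, **`oddSectorial_excQS_strict`** (`OddSectorial (excQS W₀ M S) ((c√5/3)·τ)` from the
per-slot sector `τ` and the common transverse window of the slot response matrices `slotQ W₀ M S s`) and **`oddSectorial_excQS_strict_of_slot`**
(the hypothesis shape of p644915 plus ONE clause: the transverse form of `f_{T_s}(B)` lies in `[y, c·y]·|P_s x|²`).  §4: slot-dependent windows
inside one box (`oddSectorial_excQS_strict_of_slotWindows`) and the window clause DISCHARGED for SYMMETRIC blocks (`qsResp_window_symm`,
`qsResp_window_symm_projPerp`: `f_T(hi)|P_s x|² ≤ (P_s x)ᵀ f_T(B) (P_s x) ≤ f_T(lo)|P_s x|²`, from the worker's Loewner and quasi-static pinches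
p642614/p643071) — the `τ = 0` skeleton of the remaining per-slot obligation; the sectorial (non-symmetric) case is NOT treated here.
No named facts, no sorry.  NOT a proof of the stub, of the crux, of Onsager's conjecture or of anomalous dissipation — rung-leaf F-D1.A0 algebra.
Planner seat `ad-ideate-p5` g8 (lens «profile»), 2026-08-28; Theorems-ready text for a prover lander.
-/

set_option linter.dupNamespace false
set_option linter.style.longLine false

noncomputable section

namespace Summit.AnomalousDissipation.AnomalousDissipation.Theorems.SolenoidalFractalHomogenisation.LagrangianStep.OddGain

open Matrix Finset

/-! ## Vocabulary -/

/-- Gram determinant of the symmetrised bilinear form of `M` on the pair `(p, q)`. -/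
def gram2 (M : Matrix (Fin 3) (Fin 3) ℝ) (p q : Fin 3 → ℝ) : ℝ :=
  (p ⬝ᵥ M *ᵥ p) * (q ⬝ᵥ M *ᵥ q) - ((p ⬝ᵥ M *ᵥ q + q ⬝ᵥ M *ᵥ p) / 2) ^ 2

/-- The transverse form `1 − n nᵀ` of a (unit) normal `n`. -/
def perpMat (n : Fin 3 → ℝ) : Matrix (Fin 3) (Fin 3) ℝ := 1 - Matrix.vecMulVec n n

/-- `|P_n x|² = |x|² − (n·x)²` for a unit normal `n`. -/
def perpSq (n x : Fin 3 → ℝ) : ℝ := x ⬝ᵥ x - (n ⬝ᵥ x) ^ 2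

/-- cross product in coordinates (local copy; only its coordinate formula is used). -/
def cross3 (p q : Fin 3 → ℝ) : Fin 3 → ℝ :=
  ![p 1 * q 2 - p 2 * q 1, p 2 * q 0 - p 0 * q 2, p 0 * q 1 - p 1 * q 0]

/-! ## Coordinate expansions -/

theorem dotProduct_fin_three (x y : Fin 3 → ℝ) : x ⬝ᵥ y = x 0 * y 0 + x 1 * y 1 + x 2 * y 2 := by
  simp [dotProduct, Fin.sum_univ_three]

theorem form_fin_three (M : Matrix (Fin 3) (Fin 3) ℝ) (x y : Fin 3 → ℝ) :
    x ⬝ᵥ M *ᵥ y = x 0 * (M 0 0 * y 0 + M 0 1 * y 1 + M 0 2 * y 2) + x 1 * (M 1 0 * y 0 + M 1 1 * y 1 + M 1 2 * y 2)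
      + x 2 * (M 2 0 * y 0 + M 2 1 * y 1 + M 2 2 * y 2) := by
  simp [dotProduct, Matrix.mulVec, Fin.sum_univ_three]

/-- The bilinear form of `1 − n nᵀ`. [folklore] -/
theorem form_perpMat (n x y : Fin 3 → ℝ) : x ⬝ᵥ (perpMat n) *ᵥ y = x ⬝ᵥ y - (n ⬝ᵥ x) * (n ⬝ᵥ y) := by
  rw [perpMat, form_fin_three, dotProduct_fin_three, dotProduct_fin_three, dotProduct_fin_three]
  simp [Matrix.sub_apply, Matrix.vecMulVec_apply, Matrix.one_apply_eq, Matrix.one_apply_ne]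
  ring

theorem form_perpMat_self (n x : Fin 3 → ℝ) : x ⬝ᵥ (perpMat n) *ᵥ x = perpSq n x := by
  rw [form_perpMat, perpSq, sq]

/-- bilinear expansion of a quadratic form at `p + t q`. [folklore] -/
theorem form_add_smul (M : Matrix (Fin 3) (Fin 3) ℝ) (p q : Fin 3 → ℝ) (t : ℝ) :
    (p + t • q) ⬝ᵥ M *ᵥ (p + t • q) = (q ⬝ᵥ M *ᵥ q) * (t * t) + (p ⬝ᵥ M *ᵥ q + q ⬝ᵥ M *ᵥ p) * t + p ⬝ᵥ M *ᵥ p := by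
  simp only [Matrix.mulVec_add, Matrix.mulVec_smul, dotProduct_add, add_dotProduct, dotProduct_smul, smul_dotProduct, smul_eq_mul]
  ring

/-- the form of a difference `c • A − B`. [folklore] -/
theorem form_smul_sub (c : ℝ) (A B : Matrix (Fin 3) (Fin 3) ℝ) (x y : Fin 3 → ℝ) :
    x ⬝ᵥ (c • A - B) *ᵥ y = c * (x ⬝ᵥ A *ᵥ y) - x ⬝ᵥ B *ᵥ y := by
  rw [Matrix.sub_mulVec, Matrix.smul_mulVec, dotProduct_sub, dotProduct_smul, smul_eq_mul]

/-- the form of a weighted sum. [folklore] -/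
theorem form_sum {ι : Type*} (s : Finset ι) (w : ι → ℝ) (M : ι → Matrix (Fin 3) (Fin 3) ℝ) (x y : Fin 3 → ℝ) :
    x ⬝ᵥ (∑ i ∈ s, w i • M i) *ᵥ y = ∑ i ∈ s, w i * (x ⬝ᵥ (M i) *ᵥ y) := by
  rw [Matrix.sum_mulVec, dotProduct_sum]
  refine Finset.sum_congr rfl fun i _ => ?_
  rw [Matrix.smul_mulVec, dotProduct_smul, smul_eq_mul]

/-- `gram2` scales quadratically. [folklore] -/
theorem gram2_smul (c : ℝ) (M : Matrix (Fin 3) (Fin 3) ℝ) (p q : Fin 3 → ℝ) :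
    gram2 (c • M) p q = c ^ 2 * gram2 M p q := by
  simp only [gram2, Matrix.smul_mulVec, dotProduct_smul, smul_eq_mul]
  ring

/-! ## `2×2` positive-semidefinite data and determinant monotonicity -/

/-- PSD Gram data of a form that is nonnegative along the line `p + t q` and at `q`. [folklore] -/
theorem psd_data (D : Matrix (Fin 3) (Fin 3) ℝ) (p q : Fin 3 → ℝ) (hpt : ∀ t : ℝ, 0 ≤ (p + t • q) ⬝ᵥ D *ᵥ (p + t • q))
    (hq : 0 ≤ q ⬝ᵥ D *ᵥ q) :
    0 ≤ p ⬝ᵥ D *ᵥ p ∧ 0 ≤ q ⬝ᵥ D *ᵥ q ∧ ((p ⬝ᵥ D *ᵥ q + q ⬝ᵥ D *ᵥ p) / 2) ^ 2 ≤ (p ⬝ᵥ D *ᵥ p) * (q ⬝ᵥ D *ᵥ q) := by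
  have h0 : 0 ≤ p ⬝ᵥ D *ᵥ p := by simpa using hpt 0
  refine ⟨h0, hq, ?_⟩
  have h' : ∀ t : ℝ, 0 ≤ (q ⬝ᵥ D *ᵥ q) * (t * t) + (p ⬝ᵥ D *ᵥ q + q ⬝ᵥ D *ᵥ p) * t + p ⬝ᵥ D *ᵥ p := by
    intro t; rw [← form_add_smul]; exact hpt t
  have hd := discrim_le_zero h'
  rw [discrim] at hd
  nlinarith [hd]

/-- **`2×2` determinant monotonicity on Gram data**: if `A = (a₁₁, a₁₂, a₂₂)` and `D = (d₁₁, d₁₂, d₂₂)` are positive semidefinite then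
`det A ≤ det (A + D)`. [folklore] -/
theorem det_mono_two {a11 a12 a22 d11 d12 d22 : ℝ} (ha11 : 0 ≤ a11) (ha22 : 0 ≤ a22) (ha : a12 ^ 2 ≤ a11 * a22)
    (hd11 : 0 ≤ d11) (hd22 : 0 ≤ d22) (hd : d12 ^ 2 ≤ d11 * d22) :
    a11 * a22 - a12 ^ 2 ≤ (a11 + d11) * (a22 + d22) - (a12 + d12) ^ 2 := by
  have hprod : a12 ^ 2 * d12 ^ 2 ≤ (a11 * a22) * (d11 * d22) := mul_le_mul ha hd (sq_nonneg _) (mul_nonneg ha11 ha22)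
  have h1 : (2 * (a12 * d12)) ^ 2 ≤ (a11 * d22 + a22 * d11) ^ 2 := by
    nlinarith [hprod, sq_nonneg (a11 * d22 - a22 * d11)]
  have hnn : 0 ≤ a11 * d22 + a22 * d11 := by positivity
  have h2 : 2 * (a12 * d12) ≤ a11 * d22 + a22 * d11 := (le_abs_self _).trans (abs_le_of_sq_le_sq h1 hnn)
  nlinarith [h2, hd]

/-! ## Vector algebra: the compression factor `(n·κ)²` -/

/-- Lagrange's identity `|p|²|q|² − (p·q)² = |p × q|²`. [folklore] -/
theorem lagrange_fin_three (p q : Fin 3 → ℝ) :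
    (p ⬝ᵥ p) * (q ⬝ᵥ q) - (p ⬝ᵥ q) ^ 2 = cross3 p q ⬝ᵥ cross3 p q := by
  simp only [dotProduct_fin_three, cross3, Matrix.cons_val_zero, Matrix.cons_val_one, Matrix.cons_val_two, Matrix.head_cons,
    Matrix.tail_cons]
  ring

/-- `gram2 (1 − nnᵀ) p q = (1 − |n|²)|p × q|² + (n·(p × q))²` (pure identity; at `|n| = 1` the first term drops). [folklore] -/
theorem gram2_perpMat_cross (n p q : Fin 3 → ℝ) :
    gram2 (perpMat n) p q = (1 - n ⬝ᵥ n) * (cross3 p q ⬝ᵥ cross3 p q) + (n ⬝ᵥ cross3 p q) ^ 2 := by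
  rw [gram2, form_perpMat, form_perpMat, form_perpMat, form_perpMat]
  simp only [dotProduct_fin_three, cross3, Matrix.cons_val_zero, Matrix.cons_val_one, Matrix.cons_val_two,
    Matrix.head_cons, Matrix.tail_cons]
  ring

/-- For a unit `κ` and `p, q ⊥ κ`, `p × q = ((p × q)·κ) κ` (coordinatewise). [folklore] -/
theorem cross3_eq_smul (κ p q : Fin 3 → ℝ) (hκ : κ ⬝ᵥ κ = 1) (hp : p ⬝ᵥ κ = 0) (hq : q ⬝ᵥ κ = 0) (a : Fin 3) :
    cross3 p q a = (cross3 p q ⬝ᵥ κ) * κ a := by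
  rw [dotProduct_fin_three] at hκ hp hq ⊢
  fin_cases a <;>
  simp only [cross3, Matrix.cons_val_zero, Matrix.cons_val_one, Matrix.cons_val_two, Matrix.head_cons, Matrix.tail_cons,
    Fin.zero_eta, Fin.mk_one, Fin.reduceFinMk]
  · linear_combination (-(p 1 * q 2 - p 2 * q 1)) * hκ + (p 1 * κ 2 - p 2 * κ 1) * hq - (q 1 * κ 2 - q 2 * κ 1) * hp
  · linear_combination (-(p 2 * q 0 - p 0 * q 2)) * hκ + (p 2 * κ 0 - p 0 * κ 2) * hq - (q 2 * κ 0 - q 0 * κ 2) * hp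
  · linear_combination (-(p 0 * q 1 - p 1 * q 0)) * hκ + (p 0 * κ 1 - p 1 * κ 0) * hq - (q 0 * κ 1 - q 1 * κ 0) * hp

/-- **The compression factor**: for a unit normal `n`, a unit `κ` and `p, q ⊥ κ`,
`gram2 (1 − nnᵀ) p q = (n·κ)² · (|p|²|q|² − (p·q)²)`. [folklore] -/
theorem gram2_perpMat_eq (n κ p q : Fin 3 → ℝ) (hn : n ⬝ᵥ n = 1) (hκ : κ ⬝ᵥ κ = 1) (hp : p ⬝ᵥ κ = 0) (hq : q ⬝ᵥ κ = 0) :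
    gram2 (perpMat n) p q = (n ⬝ᵥ κ) ^ 2 * ((p ⬝ᵥ p) * (q ⬝ᵥ q) - (p ⬝ᵥ q) ^ 2) := by
  have h0 := cross3_eq_smul κ p q hκ hp hq 0
  have h1 := cross3_eq_smul κ p q hκ hp hq 1
  have h2 := cross3_eq_smul κ p q hκ hp hq 2
  set W := cross3 p q ⬝ᵥ κ with hW
  have hnw : n ⬝ᵥ cross3 p q = W * (n ⬝ᵥ κ) := by
    rw [dotProduct_fin_three, dotProduct_fin_three n κ]
    linear_combination n 0 * h0 + n 1 * h1 + n 2 * h2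
  have hww : cross3 p q ⬝ᵥ cross3 p q = W ^ 2 := by
    rw [dotProduct_fin_three] at hκ
    rw [dotProduct_fin_three]
    linear_combination (cross3 p q 0 + W * κ 0) * h0 + (cross3 p q 1 + W * κ 1) * h1 + (cross3 p q 2 + W * κ 2) * h2 + W ^ 2 * hκ
  rw [gram2_perpMat_cross, lagrange_fin_three, hn, hnw, hww]
  ring

/-! ## The strict reversed-Minkowski inequality -/

/-- `|P_n x|² ≥ 0` for a unit `n` (Cauchy–Schwarz). [folklore] -/
theorem perpSq_nonneg (n x : Fin 3 → ℝ) (hn : n ⬝ᵥ n = 1) : 0 ≤ perpSq n x := by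
  rw [perpSq, dotProduct_fin_three, dotProduct_fin_three]
  rw [dotProduct_fin_three] at hn
  nlinarith [sq_nonneg (x 0 - (n 0 * x 0 + n 1 * x 1 + n 2 * x 2) * n 0), sq_nonneg (x 1 - (n 0 * x 0 + n 1 * x 1 + n 2 * x 2) * n 1),
    sq_nonneg (x 2 - (n 0 * x 0 + n 1 * x 1 + n 2 * x 2) * n 2)]

/-- PER LINE: a response matrix in the window `y|P_n x|² ≤ xᵀMx ≤ c·y·|P_n x|²` has `gram2 M p q ≤ (c y)²·(n·κ)²·(|p|²|q|² − (p·q)²)` for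
`p, q ⊥ κ`. [folklore] -/
theorem gram2_le_line (M : Matrix (Fin 3) (Fin 3) ℝ) (n κ p q : Fin 3 → ℝ) {y c : ℝ} (hy : 0 ≤ y)
    (hn : n ⬝ᵥ n = 1) (hκ : κ ⬝ᵥ κ = 1) (hp : p ⬝ᵥ κ = 0) (hq : q ⬝ᵥ κ = 0)
    (hwin : ∀ x, y * perpSq n x ≤ x ⬝ᵥ M *ᵥ x ∧ x ⬝ᵥ M *ᵥ x ≤ c * y * perpSq n x) :
    gram2 M p q ≤ (c * y) ^ 2 * ((n ⬝ᵥ κ) ^ 2 * ((p ⬝ᵥ p) * (q ⬝ᵥ q) - (p ⬝ᵥ q) ^ 2)) := by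
  -- PSD data of `M` and of `D = (c y)•(1 − nnᵀ) − M`
  have hMnn : ∀ x, 0 ≤ x ⬝ᵥ M *ᵥ x := fun x => le_trans (mul_nonneg hy (perpSq_nonneg n x hn)) (hwin x).1
  have hDnn : ∀ x, 0 ≤ x ⬝ᵥ ((c * y) • perpMat n - M) *ᵥ x := by
    intro x; rw [form_smul_sub, form_perpMat_self]; linarith [(hwin x).2]
  obtain ⟨a11, a22, a12⟩ := psd_data M p q (fun t => hMnn _) (hMnn q)
  obtain ⟨d11, d22, d12⟩ := psd_data ((c * y) • perpMat n - M) p q (fun t => hDnn _) (hDnn q)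
  have key := det_mono_two a11 a22 a12 d11 d22 d12
  -- `A + D` is the Gram data of `(c y)•(1 − nnᵀ)`
  rw [form_smul_sub, form_smul_sub, form_smul_sub, form_smul_sub] at key
  rw [← gram2_perpMat_eq n κ p q hn hκ hp hq, ← gram2_smul]
  unfold gram2
  simp only [Matrix.smul_mulVec, dotProduct_smul, smul_eq_mul]
  nlinarith [key]

/-- THE SUM: the Gram determinant of `Σ_i w_i M_i` on `p, q ⊥ κ` is at least `(a y)²·(|p|²|q|² − (p·q)²)`. [folklore] -/
theorem gram2_sum_ge {ι : Type*} (s : Finset ι) (w : ι → ℝ) (n : ι → Fin 3 → ℝ) (M : ι → Matrix (Fin 3) (Fin 3) ℝ)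
    (κ p q : Fin 3 → ℝ) {y a : ℝ} (hy : 0 ≤ y) (ha : 0 ≤ a) (hw : ∀ i ∈ s, 0 ≤ w i)
    (hp : p ⬝ᵥ κ = 0) (hq : q ⬝ᵥ κ = 0)
    (hwin : ∀ i ∈ s, ∀ x, y * perpSq (n i) x ≤ x ⬝ᵥ (M i) *ᵥ x)
    (hiso : ∀ v, v ⬝ᵥ κ = 0 → a * (v ⬝ᵥ v) ≤ ∑ i ∈ s, w i * perpSq (n i) v) :
    (a * y) ^ 2 * ((p ⬝ᵥ p) * (q ⬝ᵥ q) - (p ⬝ᵥ q) ^ 2) ≤ gram2 (∑ i ∈ s, w i • M i) p q := by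
  -- `D = G − (a y)•1` is nonnegative on `κ⊥`
  have hG : ∀ x, x ⬝ᵥ κ = 0 → (a * y) * (x ⬝ᵥ x) ≤ x ⬝ᵥ (∑ i ∈ s, w i • M i) *ᵥ x := by
    intro x hx
    rw [form_sum]
    calc (a * y) * (x ⬝ᵥ x) = y * (a * (x ⬝ᵥ x)) := by ring
      _ ≤ y * ∑ i ∈ s, w i * perpSq (n i) x := mul_le_mul_of_nonneg_left (hiso x hx) hy
      _ = ∑ i ∈ s, w i * (y * perpSq (n i) x) := by rw [Finset.mul_sum]; exact Finset.sum_congr rfl fun i _ => by ring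
      _ ≤ ∑ i ∈ s, w i * (x ⬝ᵥ (M i) *ᵥ x) := Finset.sum_le_sum fun i hi => mul_le_mul_of_nonneg_left (hwin i hi x) (hw i hi)
  have hDnn : ∀ x, x ⬝ᵥ κ = 0 → 0 ≤ x ⬝ᵥ ((∑ i ∈ s, w i • M i) - (a * y) • (1 : Matrix (Fin 3) (Fin 3) ℝ)) *ᵥ x := by
    intro x hx
    rw [Matrix.sub_mulVec, dotProduct_sub, Matrix.smul_mulVec, dotProduct_smul, Matrix.one_mulVec, smul_eq_mul]
    linarith [hG x hx]
  have hperp : ∀ t : ℝ, (p + t • q) ⬝ᵥ κ = 0 := by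
    intro t; rw [add_dotProduct, smul_dotProduct, hp, hq, smul_zero, add_zero]
  obtain ⟨d11, d22, d12⟩ := psd_data ((∑ i ∈ s, w i • M i) - (a * y) • (1 : Matrix (Fin 3) (Fin 3) ℝ)) p q
    (fun t => hDnn _ (hperp t)) (hDnn q hq)
  -- PSD data of `(a y)•1`
  have hω : 0 ≤ (p ⬝ᵥ p) * (q ⬝ᵥ q) - (p ⬝ᵥ q) ^ 2 := by
    rw [lagrange_fin_three, dotProduct_fin_three]
    nlinarith [mul_self_nonneg (cross3 p q 0), mul_self_nonneg (cross3 p q 1), mul_self_nonneg (cross3 p q 2)]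
  have hpp : 0 ≤ p ⬝ᵥ p := by rw [dotProduct_fin_three]; nlinarith [mul_self_nonneg (p 0), mul_self_nonneg (p 1), mul_self_nonneg (p 2)]
  have hqq : 0 ≤ q ⬝ᵥ q := by rw [dotProduct_fin_three]; nlinarith [mul_self_nonneg (q 0), mul_self_nonneg (q 1), mul_self_nonneg (q 2)]
  have hay : 0 ≤ a * y := mul_nonneg ha hy
  have key := det_mono_two (a11 := (a * y) * (p ⬝ᵥ p)) (a12 := (a * y) * (p ⬝ᵥ q)) (a22 := (a * y) * (q ⬝ᵥ q))
    (mul_nonneg hay hpp) (mul_nonneg hay hqq) (by nlinarith [mul_nonneg (mul_nonneg hay hay) hω]) d11 d22 d12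
  simp only [Matrix.sub_mulVec, dotProduct_sub, Matrix.smul_mulVec, dotProduct_smul, Matrix.one_mulVec, smul_eq_mul] at key
  unfold gram2
  have hsym : q ⬝ᵥ p = p ⬝ᵥ q := dotProduct_comm q p
  rw [hsym] at key
  nlinarith [key]

/-- **STRICT REVERSED MINKOWSKI (Gram form)**.  Weights `w_i ≥ 0`, unit normals `n_i`, response matrices `M_i` in the common transverse
window `y|P_{n_i}x|² ≤ xᵀM_ix ≤ c·y·|P_{n_i}x|²` (`y ≥ 0`, `c ≥ 0`), a unit output direction `κ`, a lower frame constant `a > 0` on `κ⊥`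
and an upper bound `B` for `Σ_i w_i |n_i·κ|`.  Then for all `p, q ⊥ κ`:
`Σ_i w_i √(gram2 M_i p q) ≤ (c·B/a) · √(gram2 (Σ_i w_i M_i) p q)`.
With `γ := c·B/a < 1` this is the Minkowski DEFECT that makes the Kato sector CONTRACT under the slot sum. [folklore] -/
theorem strictMinkowski_gram {ι : Type*} (s : Finset ι) (w : ι → ℝ) (n : ι → Fin 3 → ℝ) (M : ι → Matrix (Fin 3) (Fin 3) ℝ)
    (κ p q : Fin 3 → ℝ) {y c a B : ℝ} (hy : 0 ≤ y) (hc : 0 ≤ c) (ha : 0 < a) (hw : ∀ i ∈ s, 0 ≤ w i)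
    (hn : ∀ i ∈ s, n i ⬝ᵥ n i = 1) (hκ : κ ⬝ᵥ κ = 1) (hp : p ⬝ᵥ κ = 0) (hq : q ⬝ᵥ κ = 0)
    (hwin : ∀ i ∈ s, ∀ x, y * perpSq (n i) x ≤ x ⬝ᵥ (M i) *ᵥ x ∧ x ⬝ᵥ (M i) *ᵥ x ≤ c * y * perpSq (n i) x)
    (hiso : ∀ v, v ⬝ᵥ κ = 0 → a * (v ⬝ᵥ v) ≤ ∑ i ∈ s, w i * perpSq (n i) v)
    (hB : ∑ i ∈ s, w i * |n i ⬝ᵥ κ| ≤ B) :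
    ∑ i ∈ s, w i * Real.sqrt (gram2 (M i) p q) ≤ (c * B / a) * Real.sqrt (gram2 (∑ i ∈ s, w i • M i) p q) := by
  set ω2 := (p ⬝ᵥ p) * (q ⬝ᵥ q) - (p ⬝ᵥ q) ^ 2 with hω2
  have hω : 0 ≤ ω2 := by
    rw [hω2, lagrange_fin_three, dotProduct_fin_three]
    nlinarith [mul_self_nonneg (cross3 p q 0), mul_self_nonneg (cross3 p q 1), mul_self_nonneg (cross3 p q 2)]
  have hcy : 0 ≤ c * y := mul_nonneg hc hy
  -- per line
  have hline : ∀ i ∈ s, Real.sqrt (gram2 (M i) p q) ≤ (c * y) * |n i ⬝ᵥ κ| * Real.sqrt ω2 := by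
    intro i hi
    have h := gram2_le_line (M i) (n i) κ p q hy (hn i hi) hκ hp hq (hwin i hi)
    calc Real.sqrt (gram2 (M i) p q) ≤ Real.sqrt (((c * y) * |n i ⬝ᵥ κ|) ^ 2 * ω2) := by
          apply Real.sqrt_le_sqrt; rw [mul_pow, sq_abs]; linarith [h]
      _ = (c * y) * |n i ⬝ᵥ κ| * Real.sqrt ω2 := by
          rw [Real.sqrt_mul (sq_nonneg _), Real.sqrt_sq (mul_nonneg hcy (abs_nonneg _))]
  have hnum : ∑ i ∈ s, w i * Real.sqrt (gram2 (M i) p q) ≤ (c * y) * Real.sqrt ω2 * B := by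
    calc ∑ i ∈ s, w i * Real.sqrt (gram2 (M i) p q) ≤ ∑ i ∈ s, w i * ((c * y) * |n i ⬝ᵥ κ| * Real.sqrt ω2) :=
          Finset.sum_le_sum fun i hi => mul_le_mul_of_nonneg_left (hline i hi) (hw i hi)
      _ = (c * y) * Real.sqrt ω2 * ∑ i ∈ s, w i * |n i ⬝ᵥ κ| := by
          rw [Finset.mul_sum]; exact Finset.sum_congr rfl fun i _ => by ring
      _ ≤ (c * y) * Real.sqrt ω2 * B := mul_le_mul_of_nonneg_left hB (mul_nonneg hcy (Real.sqrt_nonneg _))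
  -- the sum
  have hden : (a * y) * Real.sqrt ω2 ≤ Real.sqrt (gram2 (∑ i ∈ s, w i • M i) p q) := by
    have h := gram2_sum_ge s w n M κ p q hy ha.le hw hp hq (fun i hi x => (hwin i hi x).1) hiso
    calc (a * y) * Real.sqrt ω2 = Real.sqrt ((a * y) ^ 2 * ω2) := by
          rw [Real.sqrt_mul (sq_nonneg _), Real.sqrt_sq (mul_nonneg ha.le hy)]
      _ ≤ Real.sqrt (gram2 (∑ i ∈ s, w i • M i) p q) := Real.sqrt_le_sqrt h
  have hB0 : 0 ≤ B := le_trans (Finset.sum_nonneg fun i hi => mul_nonneg (hw i hi) (abs_nonneg _)) hB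
  have hγ : 0 ≤ c * B / a := div_nonneg (mul_nonneg hc hB0) ha.le
  calc ∑ i ∈ s, w i * Real.sqrt (gram2 (M i) p q) ≤ (c * y) * Real.sqrt ω2 * B := hnum
    _ = (c * B / a) * ((a * y) * Real.sqrt ω2) := by field_simp
    _ ≤ (c * B / a) * Real.sqrt (gram2 (∑ i ∈ s, w i • M i) p q) := mul_le_mul_of_nonneg_left hden hγ


/-! ## §2 The cubature word `W₀`: lower frame constant `a = c₀`, first absolute moment `B ≤ c₀√5/3`, `γ(c) = c·√5/3` -/

section Cubature

open Literature.Analysis Literature.Analysis.FunctionSpaces Literature.Analysis.FluidPDE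
open Literature.Analysis.FluidPDE.LatticeShear
open Literature.Algebra.EuclideanLattices (inner_fin_three norm_sq_fin_three)
open scoped Real

/-- The slot weight `c_s·(e_s·κ)²` of `bsymb_excQS` (p643421/p644278) for the cubature word. -/
def slotW (κ : Fin 3 → ℝ) (s : Fin 26) : ℝ :=
  slotCoef cubatureWord s * (∑ a, (cubatureWord.phase s).e a * κ a) ^ 2

/-- The slot normal `m̂_s` of the cubature word. -/
def slotN (s : Fin 26) : Fin 3 → ℝ := mhat (cubatureWord.phase s)

theorem slotW_nonneg (κ : Fin 3 → ℝ) (s : Fin 26) : 0 ≤ slotW κ s :=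
  mul_nonneg (slotCoef_nonneg _ _) (sq_nonneg _)

theorem slotN_unit (s : Fin 26) : slotN s ⬝ᵥ slotN s = 1 := by
  have h := sum_mhat_sq (cubatureWord.phase s)
  simp only [sq] at h
  simpa [dotProduct, slotN] using h

/-- `|m|²` of slot data. -/
def sqm (d : SlotData) : ℝ := (d.m 0 : ℝ) ^ 2 + d.m 1 ^ 2 + d.m 2 ^ 2

/-- closed form of `c_s(e_s·κ)²·|P_s v|²·period` in the integer slot data. -/
def slotTermP (d : SlotData) (κ v : Fin 3 → ℝ) : ℝ :=
  (d.τ : ℝ) * ((d.v 0 : ℝ) * κ 0 + d.v 1 * κ 1 + d.v 2 * κ 2) ^ 2 *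
    (sqm d * (v 0 ^ 2 + v 1 ^ 2 + v 2 ^ 2) - ((d.m 0 : ℝ) * v 0 + d.m 1 * v 1 + d.m 2 * v 2) ^ 2) /
    (2 * (2 * π) ^ 4 * d.n * sqm d ^ 3)

/-- closed form of `c_s(e_s·κ)²·(5(m̂_s·κ)² + |κ|²)·period`. -/
def slotTermB (d : SlotData) (κ : Fin 3 → ℝ) : ℝ :=
  (d.τ : ℝ) * ((d.v 0 : ℝ) * κ 0 + d.v 1 * κ 1 + d.v 2 * κ 2) ^ 2 *
    (5 * ((d.m 0 : ℝ) * κ 0 + d.m 1 * κ 1 + d.m 2 * κ 2) ^ 2 + sqm d * (κ 0 ^ 2 + κ 1 ^ 2 + κ 2 ^ 2)) /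
    (2 * (2 * π) ^ 4 * d.n * sqm d ^ 3)

/-- **Design identity 1** (frame completeness + second/fourth cubature moments):
`Σ_s c_s(e_s·κ)²|P_s v|²·period = (168|κ|²|v|² + 56(κ·v)²)/(32π⁴)`. [folklore] -/
theorem slotTermP_sum (κ v : Fin 3 → ℝ) :
    ∑ j, slotTermP (slots j) κ v =
      (168 * (κ 0 ^ 2 + κ 1 ^ 2 + κ 2 ^ 2) * (v 0 ^ 2 + v 1 ^ 2 + v 2 ^ 2) + 56 * (κ 0 * v 0 + κ 1 * v 1 + κ 2 * v 2) ^ 2) /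
        (32 * π ^ 4) := by
  simp only [Fin.sum_univ_succ, Fin.sum_univ_zero, slots, slotTermP, sqm, Matrix.cons_val_zero, Matrix.cons_val_succ,
    Matrix.cons_val_one, Matrix.head_cons, Matrix.cons_val_two, Matrix.tail_cons]
  push_cast
  field_simp
  ring

/-- **Design identity 2**: `Σ_s c_s(e_s·κ)²(5(m̂_s·κ)² + |κ|²)·period = 560|κ|⁴/(32π⁴)` (`= (5·56 + 280)|κ|⁴/(32π⁴)`). [folklore] -/
theorem slotTermB_sum (κ : Fin 3 → ℝ) :
    ∑ j, slotTermB (slots j) κ = 560 * (κ 0 ^ 2 + κ 1 ^ 2 + κ 2 ^ 2) ^ 2 / (32 * π ^ 4) := by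
  simp only [Fin.sum_univ_succ, Fin.sum_univ_zero, slots, slotTermB, sqm, Matrix.cons_val_zero, Matrix.cons_val_succ,
    Matrix.cons_val_one, Matrix.head_cons, Matrix.cons_val_two, Matrix.tail_cons]
  push_cast
  field_simp
  ring

/-- pure algebra behind `slotW_mul_perpSq`. -/
theorem slot_algebraP (τ r M sn n S V T c : ℝ) (hr : r ^ 2 = M) (hM : 0 < M) (hsn : sn ^ 2 = n) (hn : 0 < n) (hc : 0 < c) :
    τ / (2 * (c * r) ^ 4) * ((1 / sn) * S) ^ 2 * (V - (T / r) ^ 2) = τ * S ^ 2 * (M * V - T ^ 2) / (2 * c ^ 4 * n * M ^ 3) := by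
  have hr0 : r ≠ 0 := by rintro rfl; simp at hr; linarith
  have hsn0 : sn ≠ 0 := by rintro rfl; simp at hsn; linarith
  have hr4 : (c * r) ^ 4 = c ^ 4 * M ^ 2 := by rw [mul_pow, show r ^ 4 = (r ^ 2) ^ 2 by ring, hr]
  have e2 : ((1 / sn) * S) ^ 2 = S ^ 2 / n := by rw [mul_pow, one_div, inv_pow, hsn]; ring
  have e3 : (T / r) ^ 2 = T ^ 2 / M := by rw [div_pow, hr]
  rw [hr4, e2, e3]
  field_simp

/-- pure algebra behind `slotW_mul_moment`. -/
theorem slot_algebraB (τ r M sn n S K T c : ℝ) (hr : r ^ 2 = M) (hM : 0 < M) (hsn : sn ^ 2 = n) (hn : 0 < n) (hc : 0 < c) :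
    τ / (2 * (c * r) ^ 4) * ((1 / sn) * S) ^ 2 * (5 * (T / r) ^ 2 + K) = τ * S ^ 2 * (5 * T ^ 2 + M * K) / (2 * c ^ 4 * n * M ^ 3) := by
  have hr0 : r ≠ 0 := by rintro rfl; simp at hr; linarith
  have hsn0 : sn ≠ 0 := by rintro rfl; simp at hsn; linarith
  have hr4 : (c * r) ^ 4 = c ^ 4 * M ^ 2 := by rw [mul_pow, show r ^ 4 = (r ^ 2) ^ 2 by ring, hr]
  have e2 : ((1 / sn) * S) ^ 2 = S ^ 2 / n := by rw [mul_pow, one_div, inv_pow, hsn]; ring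
  have e3 : (T / r) ^ 2 = T ^ 2 / M := by rw [div_pow, hr]
  rw [hr4, e2, e3]
  field_simp

/-- `|m|² > 0` for admissible slot data. -/
theorem sqm_pos (d : SlotData) (h : d.ok) : 0 < sqm d := by
  unfold sqm
  rcases h.1 with h0 | h0 | h0
  · have : (d.m 0 : ℝ) ≠ 0 := by exact_mod_cast h0
    positivity
  · have : (d.m 1 : ℝ) ≠ 0 := by exact_mod_cast h0
    positivity
  · have : (d.m 2 : ℝ) ≠ 0 := by exact_mod_cast h0
    positivity

theorem norm_sq_latticeVec (d : SlotData) : ‖Torus.latticeVec d.m‖ ^ 2 = sqm d := by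
  rw [norm_sq_fin_three]; simp only [Torus.latticeVec_apply, sqm]

theorem mkPhase_e_dot (d : SlotData) (h : d.ok) (κ : Fin 3 → ℝ) :
    ∑ a, (mkPhase d h).e a * κ a = (1 / Real.sqrt d.n) * ((d.v 0 : ℝ) * κ 0 + d.v 1 * κ 1 + d.v 2 * κ 2) := by
  have he : ∀ a, (mkPhase d h).e a = (1 / Real.sqrt d.n) * d.v a := by
    intro a
    show ((1 / Real.sqrt d.n) • Torus.latticeVec d.v) a = _
    rw [PiLp.smul_apply, smul_eq_mul, Torus.latticeVec_apply]
  simp only [Fin.sum_univ_three, he]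
  ring

theorem mhat_mkPhase_dot (d : SlotData) (h : d.ok) (x : Fin 3 → ℝ) :
    mhat (mkPhase d h) ⬝ᵥ x = ((d.m 0 : ℝ) * x 0 + d.m 1 * x 1 + d.m 2 * x 2) / ‖Torus.latticeVec d.m‖ := by
  have hm : ∀ a, mhat (mkPhase d h) a = (d.m a : ℝ) / ‖Torus.latticeVec d.m‖ := by
    intro a
    show (Torus.latticeVec d.m) a / ‖Torus.latticeVec d.m‖ = _
    rw [Torus.latticeVec_apply]
  rw [dotProduct_fin_three, hm, hm, hm]
  ring

/-- PER SLOT: `c_s(e_s·κ)²·|P_s v|² = slotTermP_s(κ, v)/period`. [folklore] -/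
theorem slotW_mul_perpSq (κ v : Fin 3 → ℝ) (s : Fin 26) :
    slotW κ s * perpSq (slotN s) v = slotTermP (slots s) κ v / 3720 := by
  have hn : (0 : ℝ) < (slots s).n := by exact_mod_cast (slots_ok s).2.1
  have h := slot_algebraP ((slots s).τ : ℝ) ‖Torus.latticeVec (slots s).m‖ (sqm (slots s)) (Real.sqrt (slots s).n) (slots s).n
    (((slots s).v 0 : ℝ) * κ 0 + (slots s).v 1 * κ 1 + (slots s).v 2 * κ 2) (v 0 ^ 2 + v 1 ^ 2 + v 2 ^ 2)
    (((slots s).m 0 : ℝ) * v 0 + (slots s).m 1 * v 1 + (slots s).m 2 * v 2) (2 * π)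
    (norm_sq_latticeVec _) (sqm_pos _ (slots_ok s)) (Real.sq_sqrt hn.le) hn (by positivity)
  have hps : perpSq (slotN s) v = (v 0 ^ 2 + v 1 ^ 2 + v 2 ^ 2) -
      ((((slots s).m 0 : ℝ) * v 0 + (slots s).m 1 * v 1 + (slots s).m 2 * v 2) / ‖Torus.latticeVec (slots s).m‖) ^ 2 := by
    rw [perpSq, dotProduct_comm, slotN, show cubatureWord.phase s = mkPhase (slots s) (slots_ok s) from rfl, mhat_mkPhase_dot,
      dotProduct_fin_three]
    ring
  rw [slotW, slotCoef, period_cubatureWord, show cubatureWord.phase s = mkPhase (slots s) (slots_ok s) from rfl, mkPhase_e_dot, hps]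
  show ((slots s).τ : ℝ) / (2 * (2 * π * ‖Torus.latticeVec (slots s).m‖) ^ 4) / 3720 * _ * _ = _
  rw [slotTermP, ← h]
  ring

/-- PER SLOT: `c_s(e_s·κ)²·(5(m̂_s·κ)² + |κ|²) = slotTermB_s(κ)/period`. [folklore] -/
theorem slotW_mul_moment (κ : Fin 3 → ℝ) (s : Fin 26) :
    slotW κ s * (5 * (slotN s ⬝ᵥ κ) ^ 2 + κ ⬝ᵥ κ) = slotTermB (slots s) κ / 3720 := by
  have hn : (0 : ℝ) < (slots s).n := by exact_mod_cast (slots_ok s).2.1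
  have h := slot_algebraB ((slots s).τ : ℝ) ‖Torus.latticeVec (slots s).m‖ (sqm (slots s)) (Real.sqrt (slots s).n) (slots s).n
    (((slots s).v 0 : ℝ) * κ 0 + (slots s).v 1 * κ 1 + (slots s).v 2 * κ 2) (κ 0 ^ 2 + κ 1 ^ 2 + κ 2 ^ 2)
    (((slots s).m 0 : ℝ) * κ 0 + (slots s).m 1 * κ 1 + (slots s).m 2 * κ 2) (2 * π)
    (norm_sq_latticeVec _) (sqm_pos _ (slots_ok s)) (Real.sq_sqrt hn.le) hn (by positivity)
  have hμ : slotN s ⬝ᵥ κ = (((slots s).m 0 : ℝ) * κ 0 + (slots s).m 1 * κ 1 + (slots s).m 2 * κ 2) / ‖Torus.latticeVec (slots s).m‖ := by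
    rw [slotN, show cubatureWord.phase s = mkPhase (slots s) (slots_ok s) from rfl, mhat_mkPhase_dot]
  have hkk : κ ⬝ᵥ κ = κ 0 ^ 2 + κ 1 ^ 2 + κ 2 ^ 2 := by rw [dotProduct_fin_three]; ring
  rw [slotW, slotCoef, period_cubatureWord, show cubatureWord.phase s = mkPhase (slots s) (slots_ok s) from rfl, mkPhase_e_dot, hμ, hkk]
  show ((slots s).τ : ℝ) / (2 * (2 * π * ‖Torus.latticeVec (slots s).m‖) ^ 4) / 3720 * _ * _ = _
  rw [slotTermB, ← h]
  ring

/-- **LOWER FRAME CONSTANT `a = c₀`**: on `κ⊥`, `Σ_s c_s(e_s·κ)²|P_s v|² = c₀|v|²` (an EQUALITY — the isotropy of `W₀`,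
`isotropicWordGain_cubatureWord`, in the transverse-projector form). [folklore] -/
theorem slotW_perpSq_sum (κ v : Fin 3 → ℝ) (hκ : κ ⬝ᵥ κ = 1) (hv : v ⬝ᵥ κ = 0) :
    ∑ s, slotW κ s * perpSq (slotN s) v = c0 * (v ⬝ᵥ v) := by
  have hsum : ∑ s, slotW κ s * perpSq (slotN s) v = (∑ j, slotTermP (slots j) κ v) / 3720 := by
    rw [Finset.sum_div]; exact Finset.sum_congr rfl fun s _ => slotW_mul_perpSq κ v s
  have hκ' : κ 0 ^ 2 + κ 1 ^ 2 + κ 2 ^ 2 = 1 := by rw [dotProduct_fin_three] at hκ; linear_combination hκ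
  have hv' : κ 0 * v 0 + κ 1 * v 1 + κ 2 * v 2 = 0 := by rw [dotProduct_fin_three] at hv; linear_combination hv
  rw [hsum, slotTermP_sum, hκ', hv', dotProduct_fin_three]
  unfold c0
  field_simp
  ring

/-- **FIRST ABSOLUTE MOMENT `B ≤ c₀√5/3`**: `Σ_s c_s(e_s·κ)²|m̂_s·κ| ≤ c₀·√5/3` for unit `κ` (AM–GM `2√5|μ| ≤ 5μ² + 1` slot by
slot, then design identity 2). [folklore] -/
theorem slotW_abs_sum_le (κ : Fin 3 → ℝ) (hκ : κ ⬝ᵥ κ = 1) :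
    ∑ s, slotW κ s * |slotN s ⬝ᵥ κ| ≤ c0 * Real.sqrt 5 / 3 := by
  have hs5 : Real.sqrt 5 ^ 2 = 5 := Real.sq_sqrt (by norm_num)
  have h5 : 0 < Real.sqrt 5 := Real.sqrt_pos.2 (by norm_num)
  -- AM–GM slot by slot
  have hslot : ∀ s, 2 * Real.sqrt 5 * (slotW κ s * |slotN s ⬝ᵥ κ|) ≤ slotW κ s * (5 * (slotN s ⬝ᵥ κ) ^ 2 + κ ⬝ᵥ κ) := by
    intro s
    have hw := slotW_nonneg κ s
    have ham : 2 * Real.sqrt 5 * |slotN s ⬝ᵥ κ| ≤ 5 * (slotN s ⬝ᵥ κ) ^ 2 + 1 := by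
      nlinarith [sq_nonneg (Real.sqrt 5 * |slotN s ⬝ᵥ κ| - 1), sq_abs (slotN s ⬝ᵥ κ), hs5]
    rw [hκ]
    nlinarith [mul_le_mul_of_nonneg_left ham hw]
  have hsum : ∑ s, slotW κ s * (5 * (slotN s ⬝ᵥ κ) ^ 2 + κ ⬝ᵥ κ) = 560 / (119040 * π ^ 4) := by
    have hκ' : κ 0 ^ 2 + κ 1 ^ 2 + κ 2 ^ 2 = 1 := by rw [dotProduct_fin_three] at hκ; linear_combination hκ
    rw [show ∑ s, slotW κ s * (5 * (slotN s ⬝ᵥ κ) ^ 2 + κ ⬝ᵥ κ) = (∑ j, slotTermB (slots j) κ) / 3720 by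
      rw [Finset.sum_div]; exact Finset.sum_congr rfl fun s _ => slotW_mul_moment κ s]
    rw [slotTermB_sum, hκ']
    field_simp
    norm_num
  have key : 2 * Real.sqrt 5 * ∑ s, slotW κ s * |slotN s ⬝ᵥ κ| ≤ 560 / (119040 * π ^ 4) := by
    rw [← hsum, Finset.mul_sum]
    exact Finset.sum_le_sum fun s _ => hslot s
  have e : 2 * Real.sqrt 5 * (c0 * Real.sqrt 5 / 3) = 560 / (119040 * π ^ 4) := by
    rw [show 2 * Real.sqrt 5 * (c0 * Real.sqrt 5 / 3) = 2 * c0 * Real.sqrt 5 ^ 2 / 3 by ring, hs5]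
    unfold c0
    field_simp
    norm_num
  have h2 : 2 * Real.sqrt 5 * ∑ s, slotW κ s * |slotN s ⬝ᵥ κ| ≤ 2 * Real.sqrt 5 * (c0 * Real.sqrt 5 / 3) := by rw [e]; exact key
  exact le_of_mul_le_mul_left h2 (by positivity)

/-- **STRICT REVERSED MINKOWSKI FOR THE CUBATURE WORD** (the odd-gain certificate (L4), ELEMENTARY, explicit constant):
for a unit output direction `κ`, `p, q ⊥ κ`, and slot response matrices `M_s` in the common transverse window
`y|P_s x|² ≤ xᵀM_s x ≤ c·y·|P_s x|²` (`y, c ≥ 0`),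
`Σ_s c_s(e_s·κ)² √(gram2 M_s p q) ≤ (c·√5/3) · √(gram2 (Σ_s c_s(e_s·κ)² M_s) p q)`.
Hence the contraction factor `γ(c) = c·√5/3 < 1` for every box ratio `c < 3/√5 ≈ 1.3416`. [folklore] -/
theorem strictMinkowski_cubatureWord (κ p q : Fin 3 → ℝ) (hκ : κ ⬝ᵥ κ = 1) (hp : p ⬝ᵥ κ = 0) (hq : q ⬝ᵥ κ = 0)
    (M : Fin 26 → Matrix (Fin 3) (Fin 3) ℝ) {y c : ℝ} (hy : 0 ≤ y) (hc : 0 ≤ c)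
    (hwin : ∀ s x, y * perpSq (slotN s) x ≤ x ⬝ᵥ (M s) *ᵥ x ∧ x ⬝ᵥ (M s) *ᵥ x ≤ c * y * perpSq (slotN s) x) :
    ∑ s, slotW κ s * Real.sqrt (gram2 (M s) p q) ≤ (c * Real.sqrt 5 / 3) * Real.sqrt (gram2 (∑ s, slotW κ s • M s) p q) := by
  have h := strictMinkowski_gram (Finset.univ : Finset (Fin 26)) (slotW κ) slotN M κ p q hy hc c0_pos
    (fun s _ => slotW_nonneg κ s) (fun s _ => slotN_unit s) hκ hp hq (fun s _ x => hwin s x)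
    (fun v hv => (slotW_perpSq_sum κ v hκ hv).symm.le) (slotW_abs_sum_le κ hκ)
  have e : c * (c0 * Real.sqrt 5 / 3) / c0 = c * Real.sqrt 5 / 3 := by field_simp [c0_pos.ne']
  rwa [e] at h

/-- … so a contraction factor `γ < 1` EXISTS for every box ratio `c < 3/√5`. [folklore] -/
theorem gamma_lt_one {c : ℝ} (hc' : c < 3 / Real.sqrt 5) : c * Real.sqrt 5 / 3 < 1 := by
  have h5 : 0 < Real.sqrt 5 := Real.sqrt_pos.2 (by norm_num)
  rw [lt_div_iff₀ h5] at hc'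
  linarith

end Cubature


/-! ## §3 STRICT sectorial contraction of the quasi-static excess (the strict twin of `oddSectorial_excQS_of_slot`, p644915) -/

section Strict

open Literature.Analysis Literature.Analysis.FunctionSpaces Literature.Analysis.FluidPDE
open Literature.Analysis.FluidPDE.LatticeShear

/-- `Σ_i Σ_j p_i Q_ij q_j = pᵀ Q q`. [folklore] -/
theorem sum_sum_eq_form (Q : Matrix (Fin 3) (Fin 3) ℝ) (p q : Fin 3 → ℝ) :
    ∑ i, ∑ j, p i * Q i j * q j = p ⬝ᵥ Q *ᵥ q := by
  rw [form_fin_three]; simp only [Fin.sum_univ_three]; ring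

/-- `|P_n x|² = |x|² − (n·x)²` for a unit normal: the transverse window of this file in the `projPerp` vocabulary of p643421. [folklore] -/
theorem perpSq_eq_projPerp (n x : Fin 3 → ℝ) (hn : ∑ a, n a ^ 2 = 1) :
    ((projPerp n) *ᵥ x) ⬝ᵥ ((projPerp n) *ᵥ x) = perpSq n x := by
  simp only [Fin.sum_univ_three] at hn
  rw [perpSq, dotProduct_fin_three, dotProduct_fin_three, dotProduct_fin_three]
  simp [Matrix.mulVec, dotProduct, projPerp, Fin.sum_univ_three]
  linear_combination ((n 0 * x 0 + n 1 * x 1 + n 2 * x 2) ^ 2) * hn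

/-- The real `2×2` core: product-form sector for all `t` ⇒ Gram-form sector. -/
theorem sector_gram_aux {a b u v τ : ℝ} (hb : 0 ≤ b) (hm : ((u + v) / 2) ^ 2 ≤ a * b)
    (hst : ∀ t : ℝ, (u - v) ^ 2 ≤ τ ^ 2 * ((b * (t * t) + (u + v) * t + a) * b)) :
    (u - v) ^ 2 ≤ τ ^ 2 * (a * b - ((u + v) / 2) ^ 2) := by
  rcases hb.eq_or_lt with hb0 | hbpos
  · subst hb0
    have h0 : (u - v) ^ 2 ≤ 0 := by have := hst 0; linarith [this]
    have hm0 : ((u + v) / 2) ^ 2 ≤ 0 := by simpa using hm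
    nlinarith [h0, hm0, sq_nonneg ((u + v) / 2), mul_nonneg (sq_nonneg τ) (sq_nonneg ((u + v) / 2))]
  · have h := hst (-((u + v) / 2) / b)
    have hb0 : b ≠ 0 := hbpos.ne'
    have e : (b * ((-((u + v) / 2) / b) * (-((u + v) / 2) / b)) + (u + v) * (-((u + v) / 2) / b) + a) * b =
        a * b - ((u + v) / 2) ^ 2 := by
      field_simp
      ring
    rwa [e] at h

/-- **PRODUCT-FORM SECTOR ⇒ GRAM-FORM SECTOR**: if the form of `Q` has nonnegative diagonal and satisfies the Kato-sector condition
`(xᵀQz − zᵀQx)² ≤ τ²(xᵀQx)(zᵀQz)` for ALL `x, z`, then on every pair `(p, q)`: `(pᵀQq − qᵀQp)² ≤ τ²·gram2 Q p q` (test the sector at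
`(p + t q, q)` and optimise in `t`). [folklore] -/
theorem sector_gram (Q : Matrix (Fin 3) (Fin 3) ℝ) {τ : ℝ} (hpsd : ∀ x, 0 ≤ x ⬝ᵥ Q *ᵥ x)
    (hsec : ∀ x z : Fin 3 → ℝ, (x ⬝ᵥ Q *ᵥ z - z ⬝ᵥ Q *ᵥ x) ^ 2 ≤ τ ^ 2 * ((x ⬝ᵥ Q *ᵥ x) * (z ⬝ᵥ Q *ᵥ z))) (p q : Fin 3 → ℝ) :
    (p ⬝ᵥ Q *ᵥ q - q ⬝ᵥ Q *ᵥ p) ^ 2 ≤ τ ^ 2 * gram2 Q p q := by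
  obtain ⟨_, hb, hm⟩ := psd_data Q p q (fun t => hpsd _) (hpsd q)
  have hst : ∀ t : ℝ, (p ⬝ᵥ Q *ᵥ q - q ⬝ᵥ Q *ᵥ p) ^ 2 ≤
      τ ^ 2 * (((q ⬝ᵥ Q *ᵥ q) * (t * t) + (p ⬝ᵥ Q *ᵥ q + q ⬝ᵥ Q *ᵥ p) * t + p ⬝ᵥ Q *ᵥ p) * (q ⬝ᵥ Q *ᵥ q)) := by
    intro t
    have h := hsec (p + t • q) q
    have e1 : (p + t • q) ⬝ᵥ Q *ᵥ q = p ⬝ᵥ Q *ᵥ q + t * (q ⬝ᵥ Q *ᵥ q) := by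
      rw [add_dotProduct, smul_dotProduct, smul_eq_mul]
    have e2 : q ⬝ᵥ Q *ᵥ (p + t • q) = q ⬝ᵥ Q *ᵥ p + t * (q ⬝ᵥ Q *ᵥ q) := by
      rw [Matrix.mulVec_add, Matrix.mulVec_smul, dotProduct_add, dotProduct_smul, smul_eq_mul]
    rw [e1, e2, form_add_smul] at h
    have e3 : p ⬝ᵥ Q *ᵥ q + t * (q ⬝ᵥ Q *ᵥ q) - (q ⬝ᵥ Q *ᵥ p + t * (q ⬝ᵥ Q *ᵥ q)) = p ⬝ᵥ Q *ᵥ q - q ⬝ᵥ Q *ᵥ p := by ring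
    rwa [e3] at h
  unfold gram2
  exact sector_gram_aux hb hm hst

/-- … hence `|pᵀQq − qᵀQp| ≤ τ·√(gram2 Q p q)`. [folklore] -/
theorem abs_odd_le_sqrt_gram2 (Q : Matrix (Fin 3) (Fin 3) ℝ) {τ : ℝ} (hτ : 0 ≤ τ) (hpsd : ∀ x, 0 ≤ x ⬝ᵥ Q *ᵥ x)
    (hsec : ∀ x z : Fin 3 → ℝ, (x ⬝ᵥ Q *ᵥ z - z ⬝ᵥ Q *ᵥ x) ^ 2 ≤ τ ^ 2 * ((x ⬝ᵥ Q *ᵥ x) * (z ⬝ᵥ Q *ᵥ z))) (p q : Fin 3 → ℝ) :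
    |p ⬝ᵥ Q *ᵥ q - q ⬝ᵥ Q *ᵥ p| ≤ τ * Real.sqrt (gram2 Q p q) := by
  have h := sector_gram Q hpsd hsec p q
  have hg : 0 ≤ gram2 Q p q := by
    obtain ⟨_, _, hm⟩ := psd_data Q p q (fun t => hpsd _) (hpsd q); unfold gram2; linarith
  calc |p ⬝ᵥ Q *ᵥ q - q ⬝ᵥ Q *ᵥ p| ≤ Real.sqrt (τ ^ 2 * gram2 Q p q) := Real.abs_le_sqrt h
    _ = τ * Real.sqrt (gram2 Q p q) := by rw [Real.sqrt_mul' _ hg, Real.sqrt_sq hτ]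

/-- **STRICT SECTORIAL CONTRACTION, unit output direction** (the core): for a slot family `Q_s` whose forms are in the Kato sector `τ`
(product form, all `x, z`) and in the common transverse window `y|P_s x|² ≤ xᵀQ_s x ≤ c·y|P_s x|²`, the `slotW κ`-weighted sum is in the
sector `(c√5/3)·τ` on `κ⊥` — versus `τ` in `oddSectorial_excQS_of_slot`. [folklore] -/
theorem sector_sum_strict (Q : Fin 26 → Matrix (Fin 3) (Fin 3) ℝ) {y c τ : ℝ} (hy : 0 ≤ y) (hc : 0 ≤ c) (hτ : 0 ≤ τ)
    (hsec : ∀ s, ∀ x z : Fin 3 → ℝ, (x ⬝ᵥ (Q s) *ᵥ z - z ⬝ᵥ (Q s) *ᵥ x) ^ 2 ≤ τ ^ 2 * ((x ⬝ᵥ (Q s) *ᵥ x) * (z ⬝ᵥ (Q s) *ᵥ z)))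
    (hwin : ∀ s x, y * perpSq (slotN s) x ≤ x ⬝ᵥ (Q s) *ᵥ x ∧ x ⬝ᵥ (Q s) *ᵥ x ≤ c * y * perpSq (slotN s) x)
    (κ p q : Fin 3 → ℝ) (hκ : κ ⬝ᵥ κ = 1) (hp : p ⬝ᵥ κ = 0) (hq : q ⬝ᵥ κ = 0) :
    (∑ s, slotW κ s * (p ⬝ᵥ (Q s) *ᵥ q) - ∑ s, slotW κ s * (q ⬝ᵥ (Q s) *ᵥ p)) ^ 2 ≤
      (c * Real.sqrt 5 / 3 * τ) ^ 2 * ((∑ s, slotW κ s * (p ⬝ᵥ (Q s) *ᵥ p)) * (∑ s, slotW κ s * (q ⬝ᵥ (Q s) *ᵥ q))) := by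
  have hpsd : ∀ s x, 0 ≤ x ⬝ᵥ (Q s) *ᵥ x := fun s x =>
    (mul_nonneg hy (perpSq_nonneg _ _ (slotN_unit s))).trans (hwin s x).1
  have hγ : 0 ≤ c * Real.sqrt 5 / 3 := by positivity
  -- (1) triangle inequality + per-slot Gram sector
  have h1 : |∑ s, slotW κ s * (p ⬝ᵥ (Q s) *ᵥ q) - ∑ s, slotW κ s * (q ⬝ᵥ (Q s) *ᵥ p)| ≤
      τ * ∑ s, slotW κ s * Real.sqrt (gram2 (Q s) p q) := by
    rw [← Finset.sum_sub_distrib, Finset.mul_sum]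
    refine (Finset.abs_sum_le_sum_abs _ _).trans (Finset.sum_le_sum fun s _ => ?_)
    rw [← mul_sub, abs_mul, abs_of_nonneg (slotW_nonneg κ s)]
    calc slotW κ s * |p ⬝ᵥ (Q s) *ᵥ q - q ⬝ᵥ (Q s) *ᵥ p| ≤ slotW κ s * (τ * Real.sqrt (gram2 (Q s) p q)) :=
          mul_le_mul_of_nonneg_left (abs_odd_le_sqrt_gram2 (Q s) hτ (hpsd s) (hsec s) p q) (slotW_nonneg κ s)
      _ = τ * (slotW κ s * Real.sqrt (gram2 (Q s) p q)) := by ring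
  -- (2) the strict reversed Minkowski inequality for the cubature word
  have h2 := strictMinkowski_cubatureWord κ p q hκ hp hq Q hy hc hwin
  -- (3) `gram2 G ≤ (pᵀGp)(qᵀGq)` and `pᵀGp = Σ_s w_s pᵀQ_s p`
  have hPP : 0 ≤ ∑ s, slotW κ s * (p ⬝ᵥ (Q s) *ᵥ p) := Finset.sum_nonneg fun s _ => mul_nonneg (slotW_nonneg κ s) (hpsd s p)
  have hQQ : 0 ≤ ∑ s, slotW κ s * (q ⬝ᵥ (Q s) *ᵥ q) := Finset.sum_nonneg fun s _ => mul_nonneg (slotW_nonneg κ s) (hpsd s q)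
  have hG : gram2 (∑ s, slotW κ s • Q s) p q ≤ (∑ s, slotW κ s * (p ⬝ᵥ (Q s) *ᵥ p)) * (∑ s, slotW κ s * (q ⬝ᵥ (Q s) *ᵥ q)) := by
    unfold gram2
    simp only [form_sum]
    linarith [sq_nonneg ((∑ s, slotW κ s * (p ⬝ᵥ (Q s) *ᵥ q) + ∑ s, slotW κ s * (q ⬝ᵥ (Q s) *ᵥ p)) / 2)]
  have h3 : |∑ s, slotW κ s * (p ⬝ᵥ (Q s) *ᵥ q) - ∑ s, slotW κ s * (q ⬝ᵥ (Q s) *ᵥ p)| ≤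
      (c * Real.sqrt 5 / 3 * τ) * Real.sqrt ((∑ s, slotW κ s * (p ⬝ᵥ (Q s) *ᵥ p)) * (∑ s, slotW κ s * (q ⬝ᵥ (Q s) *ᵥ q))) :=
    calc _ ≤ τ * ∑ s, slotW κ s * Real.sqrt (gram2 (Q s) p q) := h1
      _ ≤ τ * ((c * Real.sqrt 5 / 3) * Real.sqrt (gram2 (∑ s, slotW κ s • Q s) p q)) := mul_le_mul_of_nonneg_left h2 hτ
      _ ≤ τ * ((c * Real.sqrt 5 / 3) *
            Real.sqrt ((∑ s, slotW κ s * (p ⬝ᵥ (Q s) *ᵥ p)) * (∑ s, slotW κ s * (q ⬝ᵥ (Q s) *ᵥ q)))) :=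
          mul_le_mul_of_nonneg_left (mul_le_mul_of_nonneg_left (Real.sqrt_le_sqrt hG) hγ) hτ
      _ = _ := by ring
  -- (4) square
  have hR : 0 ≤ (c * Real.sqrt 5 / 3 * τ) *
      Real.sqrt ((∑ s, slotW κ s * (p ⬝ᵥ (Q s) *ᵥ p)) * (∑ s, slotW κ s * (q ⬝ᵥ (Q s) *ᵥ q))) :=
    mul_nonneg (mul_nonneg hγ hτ) (Real.sqrt_nonneg _)
  have h4 := sq_le_sq' (abs_le.1 h3).1 (abs_le.1 h3).2
  calc _ ≤ ((c * Real.sqrt 5 / 3 * τ) *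
        Real.sqrt ((∑ s, slotW κ s * (p ⬝ᵥ (Q s) *ᵥ p)) * (∑ s, slotW κ s * (q ⬝ᵥ (Q s) *ᵥ q)))) ^ 2 := h4
    _ = _ := by rw [mul_pow, Real.sq_sqrt (mul_nonneg hPP hQQ)]

/-- **STRICT SECTORIAL CONTRACTION OF THE QUASI-STATIC EXCESS** (p5's (L5) `SectorContraction`, modulo the per-slot response data):
if every slot response matrix `Q_s = slotQ W₀ M S s` of the cubature word has its form in the Kato sector `τ` and in the common transverse window
`y|P_s x|² ≤ xᵀQ_s x ≤ c·y|P_s x|²` (`y, c, τ ≥ 0`), then `excQS W₀ M S` is in the sector `(c·√5/3)·τ` — a STRICT contraction of the sector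
for every box ratio `c < 3/√5`.  (Compare `oddSectorial_excQS_of_slot`: sector `τ`, no window needed.) [folklore] -/
theorem oddSectorial_excQS_strict (Mlag : ℝ) (S : Torus.Visc4 (Fin 3)) {y c τ : ℝ} (hy : 0 ≤ y) (hc : 0 ≤ c) (hτ : 0 ≤ τ)
    (hsec : ∀ s, ∀ x z : Fin 3 → ℝ,
      (x ⬝ᵥ (slotQ cubatureWord Mlag S s) *ᵥ z - z ⬝ᵥ (slotQ cubatureWord Mlag S s) *ᵥ x) ^ 2 ≤
        τ ^ 2 * ((x ⬝ᵥ (slotQ cubatureWord Mlag S s) *ᵥ x) * (z ⬝ᵥ (slotQ cubatureWord Mlag S s) *ᵥ z)))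
    (hwin : ∀ s x, y * perpSq (slotN s) x ≤ x ⬝ᵥ (slotQ cubatureWord Mlag S s) *ᵥ x ∧
      x ⬝ᵥ (slotQ cubatureWord Mlag S s) *ᵥ x ≤ c * y * perpSq (slotN s) x) :
    OddSectorial (excQS cubatureWord Mlag S) (c * Real.sqrt 5 / 3 * τ) := by
  intro κ p q hp hq
  rw [Torus.symb_eq_bsymb, Torus.symb_eq_bsymb, bsymb_excQS, bsymb_excQS, bsymb_excQS, bsymb_excQS]
  simp only [sum_sum_eq_form]
  by_cases hκ0 : κ ⬝ᵥ κ = 0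
  · -- `κ = 0`: all weights vanish
    have hz : κ = 0 := dotProduct_self_eq_zero.1 hκ0
    subst hz
    simp
  · -- normalise `κ`
    have hr : 0 < κ ⬝ᵥ κ := lt_of_le_of_ne (by rw [dotProduct_fin_three]; nlinarith [mul_self_nonneg (κ 0), mul_self_nonneg (κ 1), mul_self_nonneg (κ 2)]) (Ne.symm hκ0)
    set r := Real.sqrt (κ ⬝ᵥ κ) with hrdef
    have hr0 : 0 < r := Real.sqrt_pos.2 hr
    have hrr : r ^ 2 = κ ⬝ᵥ κ := Real.sq_sqrt hr.le
    let κ' : Fin 3 → ℝ := fun a => κ a / r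
    have hκ' : κ' ⬝ᵥ κ' = 1 := by
      have : κ' ⬝ᵥ κ' = (κ ⬝ᵥ κ) / r ^ 2 := by
        simp only [κ', dotProduct_fin_three]; field_simp
      rw [this, hrr]; exact div_self hκ0
    have hp' : p ⬝ᵥ κ' = 0 := by
      have : p ⬝ᵥ κ' = (p ⬝ᵥ κ) / r := by simp only [κ', dotProduct_fin_three]; field_simp
      rw [this, show p ⬝ᵥ κ = 0 from hp, zero_div]
    have hq' : q ⬝ᵥ κ' = 0 := by
      have : q ⬝ᵥ κ' = (q ⬝ᵥ κ) / r := by simp only [κ', dotProduct_fin_three]; field_simp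
      rw [this, show q ⬝ᵥ κ = 0 from hq, zero_div]
    have key := sector_sum_strict (fun s => slotQ cubatureWord Mlag S s) hy hc hτ hsec hwin κ' p q hκ' hp' hq'
    -- the weights scale by `r²`
    have ew : ∀ s (F : ℝ), slotCoef cubatureWord s * (∑ a, (cubatureWord.phase s).e a * κ a) ^ 2 * F = r ^ 2 * (slotW κ' s * F) := by
      intro s F
      have e1 : ∑ a, (cubatureWord.phase s).e a * κ a = r * ∑ a, (cubatureWord.phase s).e a * κ' a := by
        rw [Finset.mul_sum]
        refine Finset.sum_congr rfl fun a _ => ?_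
        simp only [κ']; field_simp
      rw [e1, slotW]; ring
    simp only [ew, ← Finset.mul_sum]
    have hr2 : 0 ≤ r ^ 2 := sq_nonneg r
    calc (r ^ 2 * ∑ s, slotW κ' s * (p ⬝ᵥ (slotQ cubatureWord Mlag S s) *ᵥ q) -
          r ^ 2 * ∑ s, slotW κ' s * (q ⬝ᵥ (slotQ cubatureWord Mlag S s) *ᵥ p)) ^ 2 =
        (r ^ 2) ^ 2 * (∑ s, slotW κ' s * (p ⬝ᵥ (slotQ cubatureWord Mlag S s) *ᵥ q) -
          ∑ s, slotW κ' s * (q ⬝ᵥ (slotQ cubatureWord Mlag S s) *ᵥ p)) ^ 2 := by ring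
      _ ≤ (r ^ 2) ^ 2 * ((c * Real.sqrt 5 / 3 * τ) ^ 2 * ((∑ s, slotW κ' s * (p ⬝ᵥ (slotQ cubatureWord Mlag S s) *ᵥ p)) *
          (∑ s, slotW κ' s * (q ⬝ᵥ (slotQ cubatureWord Mlag S s) *ᵥ q)))) := mul_le_mul_of_nonneg_left key (sq_nonneg _)
      _ = _ := by ring

/-- **THE STRICT TWIN OF `oddSectorial_excQS_of_slot`** (same shape of hypothesis, one more clause): if for every slot `s` the quasi-static
response `f_{T_s} = qsResp ρ T_s` maps every block `B` in the Kato sector `τ` with spectrum in `[lo, hi]` (`0 ≤ lo ≤ 1 ≤ hi`) to a matrix whose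
form is in the sector `τ` AND whose TRANSVERSE form lies in the common window `y|P_s x|² ≤ (P_s x)ᵀ f_{T_s}(B) (P_s x) ≤ c·y|P_s x|²`, then for
every background `S` with `NearIso S lo hi` in the sector `τ` the quasi-static excess `excQS W₀ M S` of the cubature word is in the sector
`(c·√5/3)·τ`: the contraction factor `κ = c√5/3 < 1` of `SectorialOddChannelBoundOn` for `c < 3/√5`. [folklore] -/
theorem oddSectorial_excQS_strict_of_slot (Mlag : ℝ) {lo hi τ y c : ℝ} (hlo : 0 ≤ lo) (hlo1 : lo ≤ 1) (hhi1 : 1 ≤ hi)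
    (hy : 0 ≤ y) (hc : 0 ≤ c) (hτ : 0 ≤ τ)
    (hL1 : ∀ s : Fin 26, ∀ B : Matrix (Fin 3) (Fin 3) ℝ,
      (∀ x z : Fin 3 → ℝ, (x ⬝ᵥ B *ᵥ z - z ⬝ᵥ B *ᵥ x) ^ 2 ≤ τ ^ 2 * ((x ⬝ᵥ B *ᵥ x) * (z ⬝ᵥ B *ᵥ z))) →
      (∀ x : Fin 3 → ℝ, lo * (x ⬝ᵥ x) ≤ x ⬝ᵥ B *ᵥ x ∧ x ⬝ᵥ B *ᵥ x ≤ hi * (x ⬝ᵥ x)) →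
      (∀ x z : Fin 3 → ℝ,
        (x ⬝ᵥ (qsResp cubatureWord.ramp (4 * Real.pi ^ 2 * ‖Torus.latticeVec (cubatureWord.phase s).m‖ ^ 2 * Mlag *
            (cubatureWord.phase s).τ) B) *ᵥ z -
         z ⬝ᵥ (qsResp cubatureWord.ramp (4 * Real.pi ^ 2 * ‖Torus.latticeVec (cubatureWord.phase s).m‖ ^ 2 * Mlag *
            (cubatureWord.phase s).τ) B) *ᵥ x) ^ 2 ≤
        τ ^ 2 * ((x ⬝ᵥ (qsResp cubatureWord.ramp (4 * Real.pi ^ 2 * ‖Torus.latticeVec (cubatureWord.phase s).m‖ ^ 2 * Mlag *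
            (cubatureWord.phase s).τ) B) *ᵥ x) *
          (z ⬝ᵥ (qsResp cubatureWord.ramp (4 * Real.pi ^ 2 * ‖Torus.latticeVec (cubatureWord.phase s).m‖ ^ 2 * Mlag *
            (cubatureWord.phase s).τ) B) *ᵥ z))) ∧
      (∀ x : Fin 3 → ℝ,
        y * perpSq (slotN s) x ≤
          ((projPerp (slotN s)) *ᵥ x) ⬝ᵥ (qsResp cubatureWord.ramp (4 * Real.pi ^ 2 * ‖Torus.latticeVec (cubatureWord.phase s).m‖ ^ 2 *
            Mlag * (cubatureWord.phase s).τ) B) *ᵥ ((projPerp (slotN s)) *ᵥ x) ∧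
        ((projPerp (slotN s)) *ᵥ x) ⬝ᵥ (qsResp cubatureWord.ramp (4 * Real.pi ^ 2 * ‖Torus.latticeVec (cubatureWord.phase s).m‖ ^ 2 *
            Mlag * (cubatureWord.phase s).τ) B) *ᵥ ((projPerp (slotN s)) *ᵥ x) ≤ c * y * perpSq (slotN s) x))
    {S : Torus.Visc4 (Fin 3)} (hS : Torus.NearIso S lo hi) (hodd : OddSectorial S τ) :
    OddSectorial (excQS cubatureWord Mlag S) (c * Real.sqrt 5 / 3 * τ) := by
  have hform : ∀ s (x z : Fin 3 → ℝ), x ⬝ᵥ (slotQ cubatureWord Mlag S s) *ᵥ z =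
      ((projPerp (slotN s)) *ᵥ x) ⬝ᵥ (qsResp cubatureWord.ramp (4 * Real.pi ^ 2 * ‖Torus.latticeVec (cubatureWord.phase s).m‖ ^ 2 *
        Mlag * (cubatureWord.phase s).τ) (regBlock S (slotN s))) *ᵥ ((projPerp (slotN s)) *ᵥ z) := by
    intro s x z
    rw [← sum_sum_eq_form, slotQ_form_eq, slotN]
  refine oddSectorial_excQS_strict Mlag S hy hc hτ (fun s x z => ?_) (fun s x => ?_)
  · obtain ⟨hsec, _⟩ := hL1 s (regBlock S (slotN s)) (sectorForm_regBlock (sum_mhat_sq _) hS hlo hodd)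
      (window_regBlock (sum_mhat_sq _) hS hlo1 hhi1)
    rw [hform, hform, hform, hform]
    exact hsec _ _
  · obtain ⟨_, hw⟩ := hL1 s (regBlock S (slotN s)) (sectorForm_regBlock (sum_mhat_sq _) hS hlo hodd)
      (window_regBlock (sum_mhat_sq _) hS hlo1 hhi1)
    rw [hform]
    exact hw x

end Strict


/-! ## §4 Slot-dependent windows, and the window clause DISCHARGED for symmetric blocks (the `τ = 0` skeleton of O2⁺) -/

section Windows

open Literature.Analysis Literature.Analysis.FunctionSpaces Literature.Analysis.FluidPDE
open Literature.Analysis.FluidPDE.LatticeShear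

/-- **Slot-dependent windows**: if slot `s` has its own transverse window `[ylo s, yhi s]·|P_s x|²` and ONE box `[y, c·y]` contains them all
(`y ≤ ylo s`, `yhi s ≤ c·y`), the strict contraction `oddSectorial_excQS_strict` applies with that box. [folklore] -/
theorem oddSectorial_excQS_strict_of_slotWindows (Mlag : ℝ) (S : Torus.Visc4 (Fin 3)) {y c τ : ℝ} (hy : 0 ≤ y) (hc : 0 ≤ c) (hτ : 0 ≤ τ)
    (ylo yhi : Fin 26 → ℝ) (hlo : ∀ s, y ≤ ylo s) (hhi : ∀ s, yhi s ≤ c * y)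
    (hsec : ∀ s, ∀ x z : Fin 3 → ℝ,
      (x ⬝ᵥ (slotQ cubatureWord Mlag S s) *ᵥ z - z ⬝ᵥ (slotQ cubatureWord Mlag S s) *ᵥ x) ^ 2 ≤
        τ ^ 2 * ((x ⬝ᵥ (slotQ cubatureWord Mlag S s) *ᵥ x) * (z ⬝ᵥ (slotQ cubatureWord Mlag S s) *ᵥ z)))
    (hwin : ∀ s x, ylo s * perpSq (slotN s) x ≤ x ⬝ᵥ (slotQ cubatureWord Mlag S s) *ᵥ x ∧
      x ⬝ᵥ (slotQ cubatureWord Mlag S s) *ᵥ x ≤ yhi s * perpSq (slotN s) x) :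
    OddSectorial (excQS cubatureWord Mlag S) (c * Real.sqrt 5 / 3 * τ) := by
  refine oddSectorial_excQS_strict Mlag S hy hc hτ hsec fun s x => ?_
  have hP := perpSq_nonneg (slotN s) x (slotN_unit s)
  exact ⟨(mul_le_mul_of_nonneg_right (hlo s) hP).trans (hwin s x).1, (hwin s x).2.trans (mul_le_mul_of_nonneg_right (hhi s) hP)⟩

/-- `x·x = Σ xᵢ²`. -/
theorem dotProduct_self_eq_sum_sq (x : Fin 3 → ℝ) : x ⬝ᵥ x = ∑ i, x i ^ 2 := by
  simp [dotProduct, sq]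

/-- **THE WINDOW CLAUSE FOR SYMMETRIC BLOCKS** (the `τ = 0` skeleton of the remaining per-slot obligation O2⁺): for a SYMMETRIC block `B`
with `lo|x|² ≤ xᵀBx ≤ hi|x|²` the quasi-static response is pinched `f_T(hi)|v|² ≤ vᵀ f_T(B) v ≤ f_T(lo)|v|²` on EVERY vector
(`f_T = qsRespScalar ρ T`, `T ≥ 0`) — the worker's Loewner pinch (p642614, invariant hyperplane `u = 0`) fed into the quasi-static pinch (p643071).
For sectorial (non-symmetric) blocks the same window is expected up to `(1 + O(τ))` — NOT proved here. [folklore] -/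
theorem qsResp_window_symm {ρ T lo hi : ℝ} (hT : 0 ≤ T) {B : Matrix (Fin 3) (Fin 3) ℝ} (hB : B.IsSymm)
    (hwin : ∀ x : Fin 3 → ℝ, lo * (x ⬝ᵥ x) ≤ x ⬝ᵥ B *ᵥ x ∧ x ⬝ᵥ B *ᵥ x ≤ hi * (x ⬝ᵥ x)) (v : Fin 3 → ℝ) :
    qsRespScalar ρ T hi * (v ⬝ᵥ v) ≤ v ⬝ᵥ (qsResp ρ T B) *ᵥ v ∧ v ⬝ᵥ (qsResp ρ T B) *ᵥ v ≤ qsRespScalar ρ T lo * (v ⬝ᵥ v) := by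
  have hu : ∀ j, ∑ i, (0 : Fin 3 → ℝ) i * B i j = 0 * (0 : Fin 3 → ℝ) j := by intro j; simp
  have hlo : ∀ w : Fin 3 → ℝ, ∑ i, (0 : Fin 3 → ℝ) i * w i = 0 → lo * ∑ i, w i ^ 2 ≤ ∑ i, ∑ j, w i * B i j * w j := by
    intro w _; rw [sum_sum_eq_form, ← dotProduct_self_eq_sum_sq]; exact (hwin w).1
  have hhi : ∀ w : Fin 3 → ℝ, ∑ i, (0 : Fin 3 → ℝ) i * w i = 0 → ∑ i, ∑ j, w i * B i j * w j ≤ hi * ∑ i, w i ^ 2 := by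
    intro w _; rw [sum_sum_eq_form, ← dotProduct_self_eq_sum_sq]; exact (hwin w).2
  have hv : ∑ i, (0 : Fin 3 → ℝ) i * v i = 0 := by simp
  have low := le_sum_sum_mul_qsResp_mul (ρ := ρ) hT (fun τ hτ => le_sum_mul_exp_neg_smul_mulVec_of_perp hB hu hhi hv hτ)
  have upp := sum_sum_mul_qsResp_mul_le (ρ := ρ) hT (fun τ hτ => sum_mul_exp_neg_smul_mulVec_le_of_perp hB hu hlo hv hτ)
  rw [sum_sum_eq_form, ← dotProduct_self_eq_sum_sq] at low upp
  exact ⟨low, upp⟩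

/-- … on the `P_s`-projected vectors, in the `perpSq` currency of this file: the extra clause of `oddSectorial_excQS_strict_of_slot` for a
symmetric block, with the slot window `[f_{T_s}(hi), f_{T_s}(lo)]`. [folklore] -/
theorem qsResp_window_symm_projPerp {ρ T lo hi : ℝ} (hT : 0 ≤ T) {B : Matrix (Fin 3) (Fin 3) ℝ} (hB : B.IsSymm)
    (hwin : ∀ x : Fin 3 → ℝ, lo * (x ⬝ᵥ x) ≤ x ⬝ᵥ B *ᵥ x ∧ x ⬝ᵥ B *ᵥ x ≤ hi * (x ⬝ᵥ x)) (s : Fin 26) (x : Fin 3 → ℝ) :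
    qsRespScalar ρ T hi * perpSq (slotN s) x ≤ ((projPerp (slotN s)) *ᵥ x) ⬝ᵥ (qsResp ρ T B) *ᵥ ((projPerp (slotN s)) *ᵥ x) ∧
    ((projPerp (slotN s)) *ᵥ x) ⬝ᵥ (qsResp ρ T B) *ᵥ ((projPerp (slotN s)) *ᵥ x) ≤ qsRespScalar ρ T lo * perpSq (slotN s) x := by
  have hn : ∑ a, slotN s a ^ 2 = 1 := by rw [← dotProduct_self_eq_sum_sq]; exact slotN_unit s
  rw [← perpSq_eq_projPerp (slotN s) x hn]
  exact qsResp_window_symm hT hB hwin _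

end Windows

end Summit.AnomalousDissipation.AnomalousDissipation.Theorems.SolenoidalFractalHomogenisation.LagrangianStep.OddGain

end
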